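import Mathlib
import Summits.PneNP.PneNP.Theorems.PstarDegreeCount
import Summits.PneNP.PneNP.Theorems.PstarExpanding74Supply
import Summits.PneNP.PneNP.Theorems.PstarGapLemma

/-!
# Supply for the gap lemma: expanding typed `P⋆` instances with simple overlaps AND bounded degree (T24.9′ by name)

FRONTIER range-avoidance ladder (cell `pnp-ideate`, ROUND-24 item T24.9′; restricted-model combinatorics — nothing here bears on `P`
versus `NP`).

Second alteration on the chain `PstarExpanding74Count/Exist/Supply`: in the R21 model `Outcome N (K·N)` take an outcome that is not
`bad74` at radius `N/(3L⁸)` AND whose deletion potential `#ovl ω + D·(hdX D ω + hdA D ω)` (overlapping pairs plus `D` times the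
high-degree witnesses of `PstarDegreeCount`) is at most `N/2` — Markov as counting in the one outcome space: the potential has total mass
`≤ (N/4)·#Outcome` once `N ≥ 320K²` and `16·D·C(KN, D)·(2N·K₀)^D ≤ K₀^{2D}`, which holds for `D = 128K²` and every `N ≥ 2`
(`degree_budget`, via `(2T)! ≥ (T+1)^T`).  Delete the larger member of every overlapping pair and every output at a variable of degree
`≥ D` (`delAll`); the sub-instance (`PstarSubInstance.restrictTo`) keeps `≥ K·N − N/2 > max (n, C·n)` outputs and is pure, typed,
`(r, 7/4)`-expanding, with simple overlaps and `MaxDegree D`.  Hence **`expandingTypedBoundedDegSOExist :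
PstarGapLemma.ExpandingTypedBoundedDegSOExist`** (with `Δ = 128(2C+3)²`, `c = 6·(1944(2C+3))⁸`) and, by the tree's
`expandingTypedBoundedDegExist_of_SO`, `PstarGapLemma.ExpandingTypedBoundedDegExist`.  Scope: arity `k = 4`.
-/

set_option linter.dupNamespace false -- `Summit.PneNP.PneNP.…`: summit = sub-problem name (D-0017 single-conjunct layout)

open Finset Literature.Computability.Complexity
open Summit.PneNP.PneNP.Theorems.PstarTyped (Typed)
open Summit.PneNP.PneNP.Theorems.PstarSALevel (varSet BoundaryExpanding SimpleOverlap)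
open Summit.PneNP.PneNP.Theorems.PstarSASDPLevel (BoundaryExpandingQ boundaryExpanding_of_Q74)
open Summit.PneNP.PneNP.Theorems.PstarExpandingModel (DPair Outcome inst isPure_inst typed_inst castAdd_ne_natAdd)
open Summit.PneNP.PneNP.Theorems.PstarUniformRepeats (card_DPair)
open Summit.PneNP.PneNP.Theorems.PstarExpanding74Count (bad74 badSet74 boundaryExpandingQ74_of_not_bad74)
open Summit.PneNP.PneNP.Theorems.PstarExpanding74Exist (two_mul_card_badSet74_lt)
open Summit.PneNP.PneNP.Theorems.PstarOverlapCount (X xs as ovl card_Outcome_X pow_four_le_card_X card_many_mul_le)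
open Summit.PneNP.PneNP.Theorems.PstarDegreeCount
open Summit.PneNP.PneNP.Theorems.PstarExpanding74Supply (delSet card_delSet_le)
open Summit.PneNP.PneNP.Theorems.PstarSubInstance
open Summit.PneNP.PneNP.Theorems.PstarGapLemma (MaxDegree ExpandingTypedBoundedDegSOExist)

namespace Summit.PneNP.PneNP.Theorems.PstarExpandingBoundedDegSupply

variable {N m : ℕ}

/-! ## The deletion potential and its Markov bound -/

/-- The deletion potential: overlapping pairs plus `D` times the high-degree witnesses. -/
def pot (D : ℕ) (ω : Outcome N m) : ℕ := (ovl ω).card + D * (hdX D ω + hdA D ω)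

/-- **Mass of the potential**: `4·Σ_ω pot D ω ≤ N·#Outcome` when `N ≥ 320K²`, `m = K·N` and the degree budget
`16·D·C(m,D)·(2N·K₀)^D ≤ K₀^{2D}` holds. -/
theorem four_mul_sum_pot_le (K D : ℕ) (hN : 2 ≤ N) (hNK : 320 * K ^ 2 ≤ N) (hm : m = K * N)
    (hD : 16 * D * m.choose D * (2 * N * Fintype.card (DPair N)) ^ D ≤ Fintype.card (DPair N) ^ (2 * D)) :
    4 * ∑ ω : Outcome N m, pot D ω ≤ N * Fintype.card (Outcome N m) := by
  classical
  unfold pot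
  rw [sum_add_distrib, ← mul_sum, sum_add_distrib, mul_add]
  have h1 := sum_card_ovl_le_card (N := N) (m := m) K hN hm.le
  have h2 := sum_hdX_le (N := N) (m := m) D
  have h3 := sum_hdA_le (N := N) (m := m) D
  set K0 := Fintype.card (DPair N) with hK0
  set Xc := Fintype.card (X N) with hXc
  have hXc' : Xc = K0 * K0 := by rw [hXc, Fintype.card_prod]
  -- the degree part: `8·D·(Σ hdX + Σ hdA) ≤ N·#Ω` from the budget
  rcases le_or_gt D m with hDm | hDm
  · have hΩ : Fintype.card (Outcome N m) = Xc ^ D * Xc ^ (m - D) := by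
      rw [card_Outcome_X, ← hXc, ← pow_add]; congr 1; omega
    have hXD : Xc ^ D = K0 ^ (2 * D) := by rw [hXc', ← sq, ← pow_mul]
    have hdeg : 8 * (D * (∑ ω : Outcome N m, hdX D ω + ∑ ω : Outcome N m, hdA D ω)) ≤ N * Fintype.card (Outcome N m) := by
      have h4 : ∑ ω : Outcome N m, hdX D ω + ∑ ω : Outcome N m, hdA D ω ≤
          2 * (N * (m.choose D * ((2 * N * K0) ^ D * Xc ^ (m - D)))) := by omega
      have h5 : 8 * (D * (2 * (N * (m.choose D * ((2 * N * K0) ^ D * Xc ^ (m - D)))))) =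
          N * ((16 * D * m.choose D * (2 * N * K0) ^ D) * Xc ^ (m - D)) := by ring
      calc 8 * (D * (∑ ω : Outcome N m, hdX D ω + ∑ ω : Outcome N m, hdA D ω))
          ≤ 8 * (D * (2 * (N * (m.choose D * ((2 * N * K0) ^ D * Xc ^ (m - D)))))) :=
            Nat.mul_le_mul_left _ (Nat.mul_le_mul_left _ h4)
        _ = N * ((16 * D * m.choose D * (2 * N * K0) ^ D) * Xc ^ (m - D)) := h5
        _ ≤ N * (K0 ^ (2 * D) * Xc ^ (m - D)) := Nat.mul_le_mul_left _ (Nat.mul_le_mul_right _ hD)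
        _ = N * Fintype.card (Outcome N m) := by rw [hΩ, hXD]
    have hov : 8 * ∑ ω : Outcome N m, (ovl ω).card ≤ N * Fintype.card (Outcome N m) := by
      calc 8 * ∑ ω : Outcome N m, (ovl ω).card ≤ 8 * (40 * K ^ 2 * Fintype.card (Outcome N m)) := Nat.mul_le_mul_left _ h1
        _ = 320 * K ^ 2 * Fintype.card (Outcome N m) := by ring
        _ ≤ N * Fintype.card (Outcome N m) := Nat.mul_le_mul_right _ hNK
    omega
  · -- `D > m`: no `D`-sets of outputs, the witnesses vanish
    have hz : ∀ ω : Outcome N m, hdX D ω = 0 ∧ hdA D ω = 0 := by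
      intro ω
      constructor <;> [unfold PstarDegreeCount.hdX; unfold PstarDegreeCount.hdA] <;>
        exact sum_eq_zero fun u _ => Nat.choose_eq_zero_of_lt (lt_of_le_of_lt (card_le_univ _) (by
          rw [Fintype.card_fin]; exact hDm))
    have hx : ∑ ω : Outcome N m, hdX D ω = 0 := sum_eq_zero fun ω _ => (hz ω).1
    have ha : ∑ ω : Outcome N m, hdA D ω = 0 := sum_eq_zero fun ω _ => (hz ω).2
    rw [hx, ha]
    have hov : 8 * ∑ ω : Outcome N m, (ovl ω).card ≤ N * Fintype.card (Outcome N m) := by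
      calc 8 * ∑ ω : Outcome N m, (ovl ω).card ≤ 8 * (40 * K ^ 2 * Fintype.card (Outcome N m)) := Nat.mul_le_mul_left _ h1
        _ = 320 * K ^ 2 * Fintype.card (Outcome N m) := by ring
        _ ≤ N * Fintype.card (Outcome N m) := Nat.mul_le_mul_right _ hNK
    omega

/-- **A triply good outcome exists**: not `bad74`, and deletion potential at most `N/2`. -/
theorem exists_good3 (K L D N : ℕ) (hL : 1944 * K ≤ L) (hL1 : 1 ≤ L) (hN : 2 ≤ N) (hNK : 320 * K ^ 2 ≤ N)
    (hD : 16 * D * (K * N).choose D * (2 * N * Fintype.card (DPair N)) ^ D ≤ Fintype.card (DPair N) ^ (2 * D)) :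
    ∃ ω : Outcome N (K * N), ¬bad74 (N / (3 * L ^ 8)) ω ∧ pot D ω ≤ N / 2 := by
  classical
  set B := badSet74 N (K * N) (N / (3 * L ^ 8)) with hB
  set M := univ.filter fun ω : Outcome N (K * N) => N / 2 < pot D ω with hM
  have h1 : 2 * B.card < Fintype.card (Outcome N (K * N)) := by
    have := two_mul_card_badSet74_lt K L N (K * N) hL hL1 hN le_rfl
    exact_mod_cast this
  -- Markov on the potential
  have hmass := four_mul_sum_pot_le (m := K * N) K D hN hNK rfl hD
  have hmk : M.card * (N / 2 + 1) ≤ ∑ ω : Outcome N (K * N), pot D ω := by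
    rw [← smul_eq_mul, ← sum_const]
    calc ∑ ω ∈ M, (N / 2 + 1) ≤ ∑ ω ∈ M, pot D ω := sum_le_sum fun ω hω => (mem_filter.1 hω).2
      _ ≤ ∑ ω : Outcome N (K * N), pot D ω := sum_le_sum_of_subset_of_nonneg (filter_subset _ _) fun _ _ _ => Nat.zero_le _
  have h2 : 2 * M.card ≤ Fintype.card (Outcome N (K * N)) := by
    have hh : N ≤ 2 * (N / 2 + 1) := by omega
    have h3 : 2 * M.card * N ≤ 4 * (M.card * (N / 2 + 1)) := by nlinarith
    have h4 : 4 * (M.card * (N / 2 + 1)) ≤ N * Fintype.card (Outcome N (K * N)) := (Nat.mul_le_mul_left _ hmk).trans hmass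
    have h5 : 2 * M.card * N ≤ Fintype.card (Outcome N (K * N)) * N := by linarith [mul_comm N (Fintype.card (Outcome N (K * N)))]
    exact Nat.le_of_mul_le_mul_right h5 (by omega)
  have h3 : (B ∪ M).card < Fintype.card (Outcome N (K * N)) := by
    have := card_union_le B M
    omega
  obtain ⟨ω, -, hω⟩ := exists_mem_notMem_of_card_lt_card (s := B ∪ M) (t := (univ : Finset (Outcome N (K * N))))
    (by rw [card_univ]; exact h3)
  rw [mem_union, not_or] at hω
  refine ⟨ω, fun hb => hω.1 ?_, ?_⟩
  · rw [hB]
    unfold PstarExpanding74Count.badSet74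
    exact mem_filter.2 ⟨mem_univ _, hb⟩
  · by_contra hlt
    push Not at hlt
    exact hω.2 (mem_filter.2 ⟨mem_univ _, hlt⟩)

/-! ## The degree budget at `D = 128K²` -/

/-- `(T+1)^T ≤ (2T)!`. -/
theorem pow_le_factorial_two_mul (T : ℕ) : (T + 1) ^ T ≤ (2 * T).factorial := by
  have h := @Nat.factorial_mul_pow_le_factorial T T
  rw [show T + T = 2 * T by ring] at h
  have h1 : 1 ≤ T.factorial := T.factorial_pos
  nlinarith

/-- `32T ≤ 4^T` for `T ≥ 5`. -/
theorem mul_le_four_pow {T : ℕ} (hT : 5 ≤ T) : 32 * T ≤ 4 ^ T := by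
  have h1 : T < 2 ^ T := Nat.lt_two_pow_self
  have h2 : 32 ≤ 2 ^ T := by
    calc 32 = 2 ^ 5 := by norm_num
      _ ≤ 2 ^ T := Nat.pow_le_pow_right (by norm_num) hT
  calc 32 * T ≤ 2 ^ T * 2 ^ T := Nat.mul_le_mul h2 h1.le
    _ = 4 ^ T := by rw [← mul_pow]; norm_num

/-- `16·D·(4K)^D ≤ D!` for `D = 128K²`, `K ≥ 1`. -/
theorem budget_factorial (K : ℕ) (hK : 1 ≤ K) : 16 * (128 * K ^ 2) * (4 * K) ^ (128 * K ^ 2) ≤ (128 * K ^ 2).factorial := by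
  set T := 64 * K ^ 2 with hT
  have hD : 128 * K ^ 2 = 2 * T := by rw [hT]; ring
  rw [hD]
  have hT5 : 5 ≤ T := by nlinarith
  have h1 := pow_le_factorial_two_mul T
  have h2 : (4 * K) ^ (2 * T) = (16 * K ^ 2) ^ T := by rw [pow_mul]; congr 1; ring
  have h3 : (4 : ℕ) ^ T * (16 * K ^ 2) ^ T = (64 * K ^ 2) ^ T := by rw [← mul_pow]; congr 1; ring
  have h4 : (64 * K ^ 2) ^ T ≤ (T + 1) ^ T := Nat.pow_le_pow_left (by omega) _
  have h5 := mul_le_four_pow hT5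
  calc 16 * (2 * T) * (4 * K) ^ (2 * T) = 32 * T * (16 * K ^ 2) ^ T := by rw [h2]; ring
    _ ≤ 4 ^ T * (16 * K ^ 2) ^ T := Nat.mul_le_mul_right _ h5
    _ = (64 * K ^ 2) ^ T := h3
    _ ≤ (T + 1) ^ T := h4
    _ ≤ (2 * T).factorial := h1

/-- **The degree budget**: `16·D·C(KN, D)·(2N·K₀)^D ≤ K₀^{2D}` for `D = 128K²`, `K ≥ 1`, `N ≥ 2`. -/
theorem degree_budget (K N : ℕ) (hK : 1 ≤ K) (hN : 2 ≤ N) :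
    16 * (128 * K ^ 2) * (K * N).choose (128 * K ^ 2) * (2 * N * Fintype.card (DPair N)) ^ (128 * K ^ 2) ≤
      Fintype.card (DPair N) ^ (2 * (128 * K ^ 2)) := by
  set D := 128 * K ^ 2 with hDdef
  set K0 := Fintype.card (DPair N) with hK0
  have hK0' : K0 = N * N - N := by rw [hK0, card_DPair]
  have hK0ge : N * N ≤ 2 * K0 := by
    rw [hK0']
    have : N + N ≤ N * N := by nlinarith
    omega
  have hfac : 0 < D.factorial := D.factorial_pos
  -- multiply through by `D!`
  refine Nat.le_of_mul_le_mul_left ?_ hfac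
  have h1 : D.factorial * (16 * D * (K * N).choose D * (2 * N * K0) ^ D) =
      16 * D * ((K * N).descFactorial D) * (2 * N * K0) ^ D := by
    rw [Nat.descFactorial_eq_factorial_mul_choose]; ring
  rw [h1]
  have h2 : (K * N).descFactorial D ≤ (K * N) ^ D := Nat.descFactorial_le_pow _ _
  have h3 : 16 * D * ((K * N).descFactorial D) * (2 * N * K0) ^ D ≤ 16 * D * ((K * N) ^ D * (2 * N * K0) ^ D) := by
    have := Nat.mul_le_mul_right ((2 * N * K0) ^ D) (Nat.mul_le_mul_left (16 * D) h2)
    linarith [this]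
  refine h3.trans ?_
  rw [← mul_pow]
  -- `16 D (2KN²K₀)^D ≤ D!·K₀^{2D}`: from `16 D (4K)^D ≤ D!` and `(2KN²K₀) ≤ (4K K₀)·K₀`... i.e. `N² ≤ 2K₀`
  have h4 : (K * N * (2 * N * K0)) ^ D ≤ (4 * K * (K0 * K0)) ^ D := by
    refine Nat.pow_le_pow_left ?_ _
    calc K * N * (2 * N * K0) = 2 * K * K0 * (N * N) := by ring
      _ ≤ 2 * K * K0 * (2 * K0) := Nat.mul_le_mul_left _ hK0ge
      _ = 4 * K * (K0 * K0) := by ring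
  have h5 := budget_factorial K hK
  calc 16 * D * (K * N * (2 * N * K0)) ^ D ≤ 16 * D * (4 * K * (K0 * K0)) ^ D := Nat.mul_le_mul_left _ h4
    _ = (16 * D * (4 * K) ^ D) * K0 ^ (2 * D) := by rw [mul_pow, ← sq, ← pow_mul]; ring
    _ ≤ D.factorial * K0 ^ (2 * D) := Nat.mul_le_mul_right _ h5

/-! ## The alteration -/

/-- All deletions: larger members of overlapping pairs, and outputs at variables of `x`- or `a`-degree `≥ D`. -/
def delAll (D : ℕ) (ω : Outcome N m) : Finset (Fin m) := delSet ω ∪ hdDelX D ω ∪ hdDelA D ω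

/-- `#delAll ≤ pot`. -/
theorem card_delAll_le {D : ℕ} (hD : 1 ≤ D) (ω : Outcome N m) : (delAll D ω).card ≤ pot D ω := by
  unfold delAll pot
  have h1 := card_delSet_le ω
  have h2 := card_hdDelX_le hD ω
  have h3 := card_hdDelA_le hD ω
  calc (delSet ω ∪ hdDelX D ω ∪ hdDelA D ω).card ≤ (delSet ω ∪ hdDelX D ω).card + (hdDelA D ω).card := card_union_le _ _
    _ ≤ (delSet ω).card + (hdDelX D ω).card + (hdDelA D ω).card := Nat.add_le_add_right (card_union_le _ _) _
    _ ≤ (ovl ω).card + D * (hdX D ω + hdA D ω) := by nlinarith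

/-- The altered instance of this file. -/
def alterD (D : ℕ) (ω : Outcome N m) : LocalMap 4 (N + N) (univ \ delAll D ω).card := restrictTo (inst ω) (univ \ delAll D ω)

/-- Degrees of a restricted instance are counted on the kept outputs. -/
theorem card_filter_varSet_restrictTo {n : ℕ} (I : LocalMap 4 n m) (S : Finset (Fin m)) (v : Fin n) :
    (univ.filter fun j' : Fin S.card => v ∈ varSet (restrictTo I S) j').card = (S.filter fun j => v ∈ varSet I j).card := by
  unfold restrictTo
  set e := (S.orderEmbOfFin rfl).toEmbedding with he
  have h : (univ.filter fun j' : Fin S.card => v ∈ varSet (restrict I e) j') =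
      univ.filter fun j' : Fin S.card => v ∈ varSet I (e j') := rfl
  have hsurj : ∀ x, x ∈ S → ∃ j' : Fin S.card, e j' = x := fun x hx => by
    have : x ∈ (univ : Finset (Fin S.card)).map e := by rw [he, map_orderEmbOfFin_univ]; exact hx
    obtain ⟨j', -, hj'⟩ := mem_map.1 this
    exact ⟨j', hj'⟩
  rw [h, ← card_map e]
  congr 1
  ext x
  rw [mem_map, mem_filter]
  constructor
  · rintro ⟨j', hj', rfl⟩
    exact ⟨orderEmb_mem S j', (mem_filter.1 hj').2⟩
  · rintro ⟨hx, hP⟩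
    obtain ⟨j', rfl⟩ := hsurj x hx
    exact ⟨j', mem_filter.2 ⟨mem_univ _, hP⟩, rfl⟩

/-- Every variable of `N + N` is a left-copy or a right-copy variable. -/
theorem castAdd_or_natAdd (v : Fin (N + N)) : (∃ u : Fin N, v = Fin.castAdd N u) ∨ ∃ u : Fin N, v = Fin.natAdd N u := by
  by_cases h : v.val < N
  · exact Or.inl ⟨⟨v.val, h⟩, Fin.ext rfl⟩
  · exact Or.inr ⟨⟨v.val - N, by omega⟩, Fin.ext (by simp; omega)⟩

/-- **Properties of the altered instance** of an outcome that is not `bad74`: pure, typed, `(r, 7/4)`-expanding, simple overlaps,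
maximum degree `≤ D`. -/
theorem alterD_props {D : ℕ} (ω : Outcome N m) {r : ℕ} (hgood : ¬bad74 r ω) :
    (alterD D ω).IsPure xorAndPred ∧ Typed (alterD D ω) ∧ BoundaryExpandingQ 7 4 r (alterD D ω) ∧ SimpleOverlap (alterD D ω) ∧
      MaxDegree D (alterD D ω) := by
  refine ⟨isPure_restrictTo (isPure_inst ω) _, typed_restrictTo (typed_inst ω) _,
    boundaryExpandingQ_restrictTo (boundaryExpandingQ74_of_not_bad74 r ω hgood) _, ?_, ?_⟩
  · refine simpleOverlap_restrictTo (pairwise_of_sdiff fun j j' hlt h2 => ?_)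
    unfold delAll
    exact mem_union_left _ (mem_union_left _ (mem_image.2 ⟨(j, j'), by
      unfold PstarOverlapCount.ovl; exact mem_filter.2 ⟨mem_univ _, hlt, h2⟩, rfl⟩))
  · intro v
    unfold alterD
    rw [card_filter_varSet_restrictTo]
    have hdisjX : Disjoint (univ \ delAll D ω) (hdDelX D ω) := by
      rw [disjoint_left]; intro j hj hj'
      exact (mem_sdiff.1 hj).2 (by unfold delAll; exact mem_union_left _ (mem_union_right _ hj'))
    have hdisjA : Disjoint (univ \ delAll D ω) (hdDelA D ω) := by
      rw [disjoint_left]; intro j hj hj'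
      exact (mem_sdiff.1 hj).2 (by unfold delAll; exact mem_union_right _ hj')
    rcases castAdd_or_natAdd v with ⟨u, rfl⟩ | ⟨u, rfl⟩
    · have hiff : ∀ j : Fin m, Fin.castAdd N u ∈ varSet (inst ω) j ↔ u ∈ xs (ω j) := fun j => by
        have h := Finset.ext_iff.1 (filter_varSet_castAdd ω u) j
        simpa [PstarDegreeCount.xdegSet] using h
      rw [filter_congr fun j _ => hiff j]
      rcases card_filter_xdeg_lt (D := D) ω u hdisjX with h | h <;> omega
    · have hiff : ∀ j : Fin m, Fin.natAdd N u ∈ varSet (inst ω) j ↔ u ∈ as (ω j) := fun j => by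
        have h := Finset.ext_iff.1 (filter_varSet_natAdd ω u) j
        simpa [PstarDegreeCount.adegSet] using h
      rw [filter_congr fun j _ => hiff j]
      rcases card_filter_adeg_lt (D := D) ω u hdisjA with h | h <;> omega

/-- The altered instance keeps at least `m − pot` outputs. -/
theorem le_card_keepD {D : ℕ} (hD : 1 ≤ D) (ω : Outcome N m) : m - pot D ω ≤ (univ \ delAll D ω).card := by
  rw [card_univ_sdiff]
  have := card_delAll_le hD ω
  omega

/-! ## The supply theorem -/

/-- **T24.9′ by name: expanding typed instances with simple overlaps and bounded degree exist at every linear stretch**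
(`Δ = 128(2C+3)²`, `c = 6·(1944(2C+3))⁸`; ratio `7/4` weakened to `3/2` only at the end). -/
theorem expandingTypedBoundedDegSOExist : ExpandingTypedBoundedDegSOExist := by
  intro C
  set K := 2 * C + 3 with hK
  set L := 1944 * K with hLdef
  set D := 128 * K ^ 2 with hDdef
  have hK1 : 1 ≤ K := by omega
  have hL1 : 1 ≤ L := by omega
  have hD1 : 1 ≤ D := by rw [hDdef]; nlinarith
  refine ⟨6 * L ^ 8, D, by positivity, fun N₀ => ?_⟩
  set N := max (max N₀ 2) (320 * K ^ 2) with hNdef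
  have hN2 : 2 ≤ N := (le_max_right _ _).trans (le_max_left _ _)
  have hN0 : N₀ ≤ N := (le_max_left _ _).trans (le_max_left _ _)
  have hNK : 320 * K ^ 2 ≤ N := le_max_right _ _
  obtain ⟨ω, hgood, hpot⟩ := exists_good3 K L D N (le_of_eq hLdef.symm) hL1 hN2 hNK (degree_budget K N hK1 hN2)
  have hkeep := le_card_keepD hD1 ω
  set m' := (univ \ delAll D ω).card with hm'
  have hbig : N + N < m' ∧ C * (N + N) ≤ m' := by
    set P := K * N with hP
    set Q := C * N with hQ
    have e1 : P = 2 * Q + 3 * N := by rw [hP, hQ, hK]; ring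
    have e2 : C * (N + N) = 2 * Q := by rw [hQ]; ring
    rw [e2]
    set o := pot D ω with ho
    constructor <;> omega
  obtain ⟨hPu, hT, hB, hS, hM⟩ := alterD_props (D := D) ω hgood
  refine ⟨N + N, by omega, m', hbig.1, hbig.2, alterD D ω, hPu, hT, ?_, hS, hM⟩
  have hdiv : (N + N) / (6 * L ^ 8) = N / (3 * L ^ 8) := by
    rw [show N + N = 2 * N by ring, show 6 * L ^ 8 = 2 * (3 * L ^ 8) by ring]
    exact Nat.mul_div_mul_left N (3 * L ^ 8) (by norm_num)
  rw [hdiv]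
  exact boundaryExpanding_of_Q74 hB

/-- … and without the overlap clause (`PstarGapLemma.ExpandingTypedBoundedDegExist`), by the tree's forgetful wiring. -/
theorem expandingTypedBoundedDegExist : PstarGapLemma.ExpandingTypedBoundedDegExist :=
  PstarGapLemma.expandingTypedBoundedDegExist_of_SO expandingTypedBoundedDegSOExist

end Summit.PneNP.PneNP.Theorems.PstarExpandingBoundedDegSupply
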